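import Summits.QuantumFields.QCD.Theorems.HeatSlicedQuarksQuarkLoopCoefficientSecondOrderExpansionAuxN

/-!
# Second-order expansion of the heat symbol — part O: expansion of `R₂(t)(0)` to third order
(line `Sketch` of crux stmt-QuantumFields-16786, stub `stub_secondOrderExpansion`, helper file)

In the core regime, entrywise at the origin,
`R₂(t)(0)_{αα} + θ² ∫₀ᵗ I₁(s)_{αα} ds + θ³ ∫₀ᵗ I₂(s)_{αα} ds = O(θ⁴ t (1+t)³ Γ(t,0))`,
and the spin trace of the `θ²` term is `−e2 t`: `Σ_α ∫₀ᵗ I₁(s)_{αα} ds = −e2 t`.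
Then the assembly: from the free majorant toolkit, the free heat calculus, the Gaussian majorant of the heat
symbol and the twisted Duhamel principle (hypothesis `hTD` = the registered aux stub `stub_twistedDuhamel`),
`‖tr[E_θ(t)(0) − E_0(t)(0)] − (θ a₁ t + θ² e2 t + θ³ a₃ t)‖ ≤ C θ⁴ t²` for `1 ≤ t`, `|θ| t ≤ c₀`
(`a₁ t = tr E₁(t)(0)`, `a₃ t = −tr ∫₀ᵗ I₂`).
-/

noncomputable section

namespace Summit.QuantumFields.QCD.Cruxes.QuarkLoopCoefficient.Sketch.SecondOrderExpansion

open Literature.MathematicalPhysics.QuantumLattice Literature.MathematicalPhysics.QuantumFieldTheory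
open Literature.Probability.LatticeModels (Site)
open Summit.QuantumFields.QCD.Theorems.QuarkLoopCoefficient
open Summit.QuantumFields.QCD.Cruxes.QuarkLoopCoefficient.Sketch.HeatSeries
open Summit.QuantumFields.QCD.Cruxes.QuarkLoopCoefficient.Sketch.FreeMajorantToolkit
open Summit.QuantumFields.QCD.Cruxes.QuarkLoopCoefficient.Sketch.SymmetricGauge
open scoped Matrix ComplexConjugate

/-- The twisted generator `(V_θ f)(w) = Σ_{v ∈ nbr2 0} Ω_θ(v, w) • (ȟ_θ(v) f(w − v))` (local notation). -/
local notation "V[" θ "]" => (fun (f : Site 4 → Spin) (w : Site 4) =>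
  ∑ v ∈ nbr2 0, Complex.exp (((θ / 2 * (wedge v w : ℤ) : ℝ) : ℂ) * Complex.I) • (sqKer (symLink θ) 0 v * f (w - v)))

/-- The second-order forcing `q₂(θ, s, w)` (local notation). -/
local notation "Q₂[" θ "," s "," w "]" => (V[θ] (pert0 s) w + (θ : ℂ) • V[θ] (pert1 s) w - vtx 0 (pert0 s) w -
  (θ : ℂ) • (vtx 0 (pert1 s) w + vtx 1 (pert0 s) w))

/-- The leading forcing `F(s, w) = vtx 2 (pert0 s) w + vtx 1 (pert1 s) w` (local notation). -/
local notation "F[" s "," w "]" => (vtx 2 (pert0 s) w + vtx 1 (pert1 s) w)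

/-- The third-order forcing `q₃'(s, w) = vtx 3 (pert0 s) w + vtx 2 (pert1 s) w` (local notation). -/
local notation "Q₃[" s "," w "]" => (vtx 3 (pert0 s) w + vtx 2 (pert1 s) w)

/-- The second-order remainder `R₂(θ, u, y) = E_θ(u)(y) − E₀(u)(y) − θ E₁(u)(y)` (local notation). -/
local notation "R₂[" θ "," u "," y "]" => (symHeat θ u y - pert0 u y - (θ : ℂ) • pert1 u y)

/-! ## §36 The trace of the second-order term is `−e2 t` -/

/-- `Σ_α ∫₀ᵗ I₁(s)_{αα} ds = −e2 t` when the leading family is summable and its entries are continuous on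
`[0, t]`. -/
theorem sum_integral_leading_eq_neg_e2
    (h7 : ∀ (t : ℝ) (w : Site 4), freeKer t (-w) = freeKer t w)
    {t : ℝ} (ht : 0 ≤ t)
    (hS : ∀ s ∈ Set.Icc 0 t, Summable (fun y : Site 4 => pert0 (t - s) y * F[s, -y]))
    (hc : ∀ α : Fin 4, ContinuousOn (fun s : ℝ => (∑' y : Site 4, pert0 (t - s) y * F[s, -y]) α α) (Set.Icc 0 t)) :
    ∑ α : Fin 4, ∫ s in (0 : ℝ)..t, (∑' y : Site 4, pert0 (t - s) y * F[s, -y]) α α = -e2 t := by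
  have hint : ∀ α ∈ (Finset.univ : Finset (Fin 4)), IntervalIntegrable
      (fun s : ℝ => (∑' y : Site 4, pert0 (t - s) y * F[s, -y]) α α) MeasureTheory.volume 0 t := by
    intro α _
    refine ContinuousOn.intervalIntegrable ?_
    rw [Set.uIcc_of_le ht]
    exact hc α
  rw [← intervalIntegral.integral_finsetSum hint, e2, neg_neg]
  refine intervalIntegral.integral_congr fun s hs => ?_
  rw [Set.uIcc_of_le ht] at hs
  exact sum_diag_tsum_pert0_mul_eq h7 (t - s) s (hS s hs)

/-! ## §37 The third-order expansion of `R₂(t)(0)` -/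

/-- **Expansion of the remainder at the origin.**  In the core regime (`0 < t`, `|θ| ≤ c₀`, `|θ| t ≤ c₀`):
`‖R₂(t)(0)_{αα} + θ² ∫₀ᵗ I₁_{αα} + θ³ ∫₀ᵗ I₂_{αα}‖ ≤ K_err θ⁴ (1+t)³ Γ(t,0) t`. -/
theorem norm_remainder₂_origin_expansion_le {Ck ck c₀ CE cE CR K C₁ Bm : ℝ} (hck : 0 < ck) (hc₀ : 0 < c₀)
    (hcE : 0 < cE) (hCk : 0 ≤ Ck) (hCE : 0 ≤ CE) (hCR : 0 ≤ CR) (hK : 0 ≤ K) (hC₁ : 0 ≤ C₁) (hBm : 0 ≤ Bm)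
    (hk : ∀ t : ℝ, 0 ≤ t → ∀ w : Site 4, |freeKer t w| ≤ Ck * gaussProfile ck t w)
    (hT5 : ∀ c : ℝ, 0 < c → ∃ A : ℝ, ∀ t : ℝ, 0 ≤ t →
      Summable (fun y : Site 4 => gaussProfile c t y) ∧ ∑' y : Site 4, gaussProfile c t y ≤ A)
    (hBmix : ∀ a b : ℝ, 0 ≤ a → 0 ≤ b → ∀ w : Site 4,
      Summable (fun y : Site 4 => gaussProfile ((1 - 1 / 2) * min cE (ck / 8)) a y *
        gaussProfile (min cE (ck / 8)) b (w - y)) ∧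
      ∑' y : Site 4, gaussProfile ((1 - 1 / 2) * min cE (ck / 8)) a y * gaussProfile (min cE (ck / 8)) b (w - y) ≤
        Bm * gaussProfile ((1 - 1 / 2) * min cE (ck / 8)) (a + b) w)
    (hE₁ : ∀ s : ℝ, 0 ≤ s → ∀ (y : Site 4) (γ δ : Fin 4), ‖pert1 s y γ δ‖ ≤ C₁ * (1 + s) * gaussProfile (ck / 2) s y)
    (hq : ∀ θ : ℝ, ∀ s : ℝ, 0 ≤ s → ∀ (w : Site 4) (γ δ : Fin 4),
      ‖(F[s, w]) γ δ‖ ≤ K * (1 + s) * gaussProfile (ck / 8) s w ∧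
      ‖(Q₃[s, w]) γ δ‖ ≤ K * (1 + s) ^ 2 * gaussProfile (ck / 8) s w ∧
      ‖(Q₂[θ, s, w]) γ δ‖ ≤ K * (θ ^ 2 * (1 + s) + |θ| ^ 3 * (1 + s) ^ 2) * gaussProfile (ck / 8) s w ∧
      ‖(Q₂[θ, s, w] - (θ : ℂ) ^ 2 • F[s, w] - (θ : ℂ) ^ 3 • Q₃[s, w]) γ δ‖ ≤
        K * θ ^ 4 * ((1 + s) ^ 2 + (1 + s) ^ 3) * gaussProfile (ck / 8) s w)
    (hGM : ∀ θ t : ℝ, 0 ≤ t → |θ| ≤ c₀ → |θ| * t ≤ c₀ →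
      ∀ (w : Site 4) (α β : Fin 4), ‖symHeat θ t w α β‖ ≤ CE * gaussProfile cE t w)
    (hR : ∀ θ t : ℝ, 0 ≤ t → |θ| ≤ c₀ → |θ| * t ≤ c₀ → ∀ (w : Site 4) (α β : Fin 4),
      ‖(R₂[θ, t, w]) α β‖ ≤ CR * θ ^ 2 * (1 + t) ^ 2 * gaussProfile (min cE (ck / 8) / 2) t w)
    (hcont : ∀ θ t : ℝ,
      (∀ (y : Site 4) (γ δ : Fin 4), ContinuousOn (fun s : ℝ => pert0 (t - s) y γ δ) (Set.Icc 0 t)) ∧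
      (∀ (y : Site 4) (γ δ : Fin 4), ContinuousOn (fun s : ℝ => pert1 (t - s) y γ δ) (Set.Icc 0 t)) ∧
      (∀ (y : Site 4) (γ δ : Fin 4), ContinuousOn (fun s : ℝ => (R₂[θ, t - s, y]) γ δ) (Set.Icc 0 t)) ∧
      (∀ (y : Site 4) (γ δ : Fin 4), ContinuousOn (fun s : ℝ => (F[s, y]) γ δ) (Set.Icc 0 t)) ∧
      (∀ (y : Site 4) (γ δ : Fin 4), ContinuousOn (fun s : ℝ => (Q₃[s, y]) γ δ) (Set.Icc 0 t)) ∧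
      (∀ (y : Site 4) (γ δ : Fin 4), ContinuousOn (fun s : ℝ => (Q₂[θ, s, y]) γ δ) (Set.Icc 0 t)))
    (hrep : ∀ (θ : ℝ) {t : ℝ}, 0 < t → ∀ (w : Site 4) (α β : Fin 4),
      (R₂[θ, t, w]) α β = -∫ s in (0 : ℝ)..t, (∑' y : Site 4,
          Complex.exp (((θ / 2 * (wedge y w : ℤ) : ℝ) : ℂ) * Complex.I) •
            (symHeat θ (t - s) y * Q₂[θ, s, w - y])) α β)
    (θ : ℝ) {t : ℝ} (ht : 0 < t) (hθ : |θ| ≤ c₀) (hθt : |θ| * t ≤ c₀) (α : Fin 4) :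
    ‖(R₂[θ, t, 0]) α α +
        (θ : ℂ) ^ 2 * (∫ s in (0 : ℝ)..t, (∑' y : Site 4, pert0 (t - s) y * F[s, -y]) α α) +
        (θ : ℂ) ^ 3 * (∫ s in (0 : ℝ)..t,
          (∑' y : Site 4, (pert0 (t - s) y * Q₃[s, -y] + pert1 (t - s) y * F[s, -y])) α α)‖ ≤
      (4 * Ck * (2 * K) + 4 * C₁ * (K * (1 + 4 * c₀)) + 4 * CR * (K * (1 + 2 * c₀))) * Bm *
        θ ^ 4 * (1 + t) ^ 3 * gaussProfile (min cE (ck / 8) / 2) t 0 * t := by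
  obtain ⟨cI, cI₁, cI₂, hsplit⟩ := integrands_continuousOn_and_split hck hc₀ hcE hCk hCE hCR hK hC₁ hBm hk hT5 hBmix hE₁
    hq hGM hR hcont θ ht.le hθ hθt α
  -- integrability on `[0, t]`
  have iI : IntervalIntegrable (fun s : ℝ => (∑' y : Site 4, symHeat θ (t - s) y * Q₂[θ, s, -y]) α α)
      MeasureTheory.volume 0 t := ContinuousOn.intervalIntegrable (by rwa [Set.uIcc_of_le ht.le])
  have iI₁ : IntervalIntegrable (fun s : ℝ => (∑' y : Site 4, pert0 (t - s) y * F[s, -y]) α α)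
      MeasureTheory.volume 0 t := ContinuousOn.intervalIntegrable (by rwa [Set.uIcc_of_le ht.le])
  have iI₂ : IntervalIntegrable (fun s : ℝ =>
      (∑' y : Site 4, (pert0 (t - s) y * Q₃[s, -y] + pert1 (t - s) y * F[s, -y])) α α)
      MeasureTheory.volume 0 t := ContinuousOn.intervalIntegrable (by rwa [Set.uIcc_of_le ht.le])
  -- the representation at the origin, phase-free
  have hR0 : (R₂[θ, t, 0]) α α = -∫ s in (0 : ℝ)..t, (∑' y : Site 4, symHeat θ (t - s) y * Q₂[θ, s, -y]) α α := by
    have e : ∀ s : ℝ, (∑' y : Site 4, Complex.exp (((θ / 2 * (wedge y 0 : ℤ) : ℝ) : ℂ) * Complex.I) •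
        (symHeat θ (t - s) y * Q₂[θ, s, 0 - y])) = ∑' y : Site 4, symHeat θ (t - s) y * Q₂[θ, s, -y] :=
      fun s => tsum_congr fun y => by rw [cexp_wedge_zero, one_smul, zero_sub]
    rw [hrep θ ht 0 α α]
    simp_rw [e]
  -- combine the three integrals into one
  have hcomb : (R₂[θ, t, 0]) α α +
      (θ : ℂ) ^ 2 * (∫ s in (0 : ℝ)..t, (∑' y : Site 4, pert0 (t - s) y * F[s, -y]) α α) +
      (θ : ℂ) ^ 3 * (∫ s in (0 : ℝ)..t,
        (∑' y : Site 4, (pert0 (t - s) y * Q₃[s, -y] + pert1 (t - s) y * F[s, -y])) α α) =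
      -∫ s in (0 : ℝ)..t, ((∑' y : Site 4, symHeat θ (t - s) y * Q₂[θ, s, -y]) α α -
        (θ : ℂ) ^ 2 * (∑' y : Site 4, pert0 (t - s) y * F[s, -y]) α α -
        (θ : ℂ) ^ 3 * (∑' y : Site 4, (pert0 (t - s) y * Q₃[s, -y] + pert1 (t - s) y * F[s, -y])) α α) := by
    have e1 : ∫ s in (0 : ℝ)..t, ((∑' y : Site 4, symHeat θ (t - s) y * Q₂[θ, s, -y]) α α -
        (θ : ℂ) ^ 2 * (∑' y : Site 4, pert0 (t - s) y * F[s, -y]) α α -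
        (θ : ℂ) ^ 3 * (∑' y : Site 4, (pert0 (t - s) y * Q₃[s, -y] + pert1 (t - s) y * F[s, -y])) α α) =
        (∫ s in (0 : ℝ)..t, (∑' y : Site 4, symHeat θ (t - s) y * Q₂[θ, s, -y]) α α) -
          (θ : ℂ) ^ 2 * (∫ s in (0 : ℝ)..t, (∑' y : Site 4, pert0 (t - s) y * F[s, -y]) α α) -
          (θ : ℂ) ^ 3 * (∫ s in (0 : ℝ)..t,
            (∑' y : Site 4, (pert0 (t - s) y * Q₃[s, -y] + pert1 (t - s) y * F[s, -y])) α α) := by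
      rw [intervalIntegral.integral_sub (iI.sub (iI₁.const_mul _)) (iI₂.const_mul _),
        intervalIntegral.integral_sub iI (iI₁.const_mul _), intervalIntegral.integral_const_mul,
        intervalIntegral.integral_const_mul]
    rw [e1, hR0]
    ring
  rw [hcomb, norm_neg]
  -- pointwise bound of the error integrand
  have hpt : ∀ s ∈ Set.Ioc 0 t, ‖(∑' y : Site 4, symHeat θ (t - s) y * Q₂[θ, s, -y]) α α -
      (θ : ℂ) ^ 2 * (∑' y : Site 4, pert0 (t - s) y * F[s, -y]) α α -
      (θ : ℂ) ^ 3 * (∑' y : Site 4, (pert0 (t - s) y * Q₃[s, -y] + pert1 (t - s) y * F[s, -y])) α α‖ ≤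
      (4 * Ck * (2 * K) + 4 * C₁ * (K * (1 + 4 * c₀)) + 4 * CR * (K * (1 + 2 * c₀))) * Bm *
        θ ^ 4 * (1 + t) ^ 3 * gaussProfile (min cE (ck / 8) / 2) t 0 := by
    intro s hs
    have hs' : s ∈ Set.Icc 0 t := ⟨hs.1.le, hs.2⟩
    rw [hsplit s hs']
    have := (integrand_families hck hc₀ hcE hCk hCE hCR hK hC₁ hBm hk hBmix hE₁ hq hGM hR θ hs'.1 hs'.2 hθ hθt).2.2.2.2 α α
    convert this using 2
    ring
  calc ‖∫ s in (0 : ℝ)..t, ((∑' y : Site 4, symHeat θ (t - s) y * Q₂[θ, s, -y]) α α -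
        (θ : ℂ) ^ 2 * (∑' y : Site 4, pert0 (t - s) y * F[s, -y]) α α -
        (θ : ℂ) ^ 3 * (∑' y : Site 4, (pert0 (t - s) y * Q₃[s, -y] + pert1 (t - s) y * F[s, -y])) α α)‖
      ≤ (4 * Ck * (2 * K) + 4 * C₁ * (K * (1 + 4 * c₀)) + 4 * CR * (K * (1 + 2 * c₀))) * Bm *
          θ ^ 4 * (1 + t) ^ 3 * gaussProfile (min cE (ck / 8) / 2) t 0 * |t - 0| :=
        intervalIntegral.norm_integral_le_of_norm_le_const fun s hs => hpt s (by rwa [Set.uIoc_of_le ht.le] at hs)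
    _ = _ := by rw [sub_zero, abs_of_pos ht]







/-! ## §38 The assembly -/

/-- **Second-order expansion of the heat symbol, given the twisted Duhamel principle.** -/
theorem secondOrderExpansion_of_twistedDuhamel
    (hTD : (∀ (θ T c B : ℝ), 0 < T → 0 < c → ∀ (X q : ℝ → Site 4 → Spin),
      (∀ w : Site 4, X 0 w = 0) →
      (∀ (w : Site 4) (α β : Fin 4), ContinuousOn (fun s => X s w α β) (Set.Icc 0 T)) →
      (∀ (w : Site 4) (α β : Fin 4), ContinuousOn (fun s => q s w α β) (Set.Icc 0 T)) →
      (∀ s ∈ Set.Ioo 0 T, ∀ (w : Site 4) (α β : Fin 4),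
        HasDerivAt (fun r => X r w α β)
          ((-(∑ v ∈ nbr2 0, Complex.exp (((θ / 2 * (wedge v w : ℤ) : ℝ) : ℂ) * Complex.I) •
              (sqKer (symLink θ) 0 v * X s (w - v))) - q s w) α β) s) →
      (∀ s ∈ Set.Icc 0 T, ∀ (w : Site 4) (α β : Fin 4), ‖X s w α β‖ ≤ B) →
      (∀ s ∈ Set.Icc 0 T, ∀ (w : Site 4) (α β : Fin 4), ‖q s w α β‖ ≤ B * gaussProfile c s w) →
      ∀ t ∈ Set.Icc 0 T, ∀ (w : Site 4) (α β : Fin 4),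
        X t w α β = -∫ s in (0 : ℝ)..t, (∑' y : Site 4,
          Complex.exp (((θ / 2 * (wedge y w : ℤ) : ℝ) : ℂ) * Complex.I) •
            (symHeat θ (t - s) y * q s (w - y))) α β)) :
    ((∃ C c : ℝ, 0 < c ∧ ∀ t : ℝ, 0 ≤ t → ∀ w : Site 4, |freeKer t w| ≤ C * gaussProfile c t w) ∧
      (∀ c ε : ℝ, 0 < c → 0 < ε → ε < 1 → ∃ B : ℝ, ∀ a b : ℝ, 0 ≤ a → 0 ≤ b → ∀ w : Site 4,
        Summable (fun y : Site 4 => gaussProfile ((1 - ε) * c) a y * gaussProfile c b (w - y)) ∧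
        ∑' y : Site 4, gaussProfile ((1 - ε) * c) a y * gaussProfile c b (w - y) ≤
          B * gaussProfile ((1 - ε) * c) (a + b) w) ∧
      (∀ c ε : ℝ, 0 < c → 0 < ε → ε < 1 → ∀ j : ℕ, ∃ A : ℝ, ∀ t : ℝ, 0 ≤ t → ∀ w : Site 4,
        elen w ^ j * gaussProfile c t w ≤ A * Real.sqrt (1 + t) ^ j * gaussProfile ((1 - ε) * c) t w) ∧
      (∀ c ε : ℝ, 0 < c → 0 < ε → ε < 1 → ∃ A : ℝ, ∀ t : ℝ, 0 ≤ t → ∀ w z : Site 4, elen z ≤ 2 →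
        gaussProfile c t (w + z) ≤ A * gaussProfile ((1 - ε) * c) t w) ∧
      (∀ c : ℝ, 0 < c → ∃ A : ℝ, ∀ t : ℝ, 0 ≤ t →
        Summable (fun y : Site 4 => gaussProfile c t y) ∧ ∑' y : Site 4, gaussProfile c t y ≤ A) ∧
      (∀ c : ℝ, 0 < c → ∃ C : ℝ, ∀ (L : ℕ), 1 ≤ L → ∀ t : ℝ, 1 ≤ t → t ≤ (L : ℝ) ^ 2 →
        Summable (fun n : Site 4 => gaussProfile c t (fun μ => (L : ℤ) * n μ)) ∧
        ∑' n : Site 4, (if n = 0 then 0 else gaussProfile c t (fun μ => (L : ℤ) * n μ)) ≤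
          C * Real.exp (-(c / 2 * (L : ℝ) ^ 2 / (t + (L : ℝ)))) / t ^ 2)) →
    ((∀ x y : Site 4, sqKer (fun _ => (1 : ℂ)) x y = ((hhat (y - x) : ℝ) : ℂ) • (1 : Spin)) ∧
      (∀ t : ℝ, 0 ≤ t → ∀ x y : Site 4,
        heatKer (fun _ => (1 : ℂ)) t x y = ((freeKer t (y - x) : ℝ) : ℂ) • (1 : Spin)) ∧
      (∀ w : Site 4, freeKer 0 w = if w = 0 then 1 else 0) ∧
      (∀ (t : ℝ) (w : Site 4),
        HasDerivAt (fun s => freeKer s w) (-(∑ z ∈ nbr2 0, hhat z * freeKer t (w - z))) t) ∧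
      (∀ s r : ℝ, 0 ≤ s → 0 ≤ r → ∀ w : Site 4,
        HasSum (fun y : Site 4 => freeKer s y * freeKer r (w - y)) (freeKer (s + r) w)) ∧
      (∀ t : ℝ, 0 ≤ t → ∀ (w : Site 4) (ν : Fin 4),
        t * (∑ z ∈ nbr2 0, ((z ν : ℤ) : ℝ) * hhat z * freeKer t (w - z)) + ((w ν : ℤ) : ℝ) * freeKer t w = 0) ∧
      (∀ (t : ℝ) (w : Site 4), freeKer t (-w) = freeKer t w)) →
    (∃ c₀ : ℝ, 0 < c₀ ∧ ∃ C c : ℝ, 0 < c ∧ ∀ θ t : ℝ, 0 ≤ t → |θ| ≤ c₀ → |θ| * t ≤ c₀ →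
        ∀ (w : Site 4) (α β : Fin 4), ‖symHeat θ t w α β‖ ≤ C * gaussProfile c t w) →
    (∃ c₀ : ℝ, 0 < c₀ ∧ ∃ C : ℝ, ∃ a₁ a₃ : ℝ → ℂ, ∀ θ t : ℝ, 1 ≤ t → |θ| * t ≤ c₀ →
        ‖(∑ α : Fin 4, (symHeat θ t 0 α α - symHeat 0 t 0 α α)) -
            ((θ : ℂ) * a₁ t + (θ : ℂ) ^ 2 * e2 t + (θ : ℂ) ^ 3 * a₃ t)‖ ≤ C * θ ^ 4 * t ^ 2) := by
  intro hTK hFHC hGM0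
  obtain ⟨⟨Ck, ck, hck, hk⟩, hT2, hT3, hT4, hT5, -⟩ := hTK
  obtain ⟨h1, h2, h3, h4, h5, h6, h7⟩ := hFHC
  obtain ⟨c₀, hc₀, CE, cE, hcE, hGM⟩ := hGM0
  have hCk : 0 ≤ Ck := by
    have := hk 0 le_rfl 0
    have h0 : 0 < gaussProfile ck 0 0 := by rw [gaussProfile_zero_right]; norm_num
    nlinarith [abs_nonneg (freeKer 0 0)]
  have hCE : 0 ≤ CE := by
    have := hGM 0 0 le_rfl (by simp [hc₀.le]) (by simp [hc₀.le]) 0 0 0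
    have h0 : 0 < gaussProfile cE 0 0 := by rw [gaussProfile_zero_right]; norm_num
    nlinarith [norm_nonneg (symHeat 0 0 0 0 0)]
  obtain ⟨C₁, hC₁0, hE₁⟩ := exists_norm_pert1_apply_le hck hk hT4 h1 h3 h5 h6
  obtain ⟨K, hK0, hq⟩ := exists_forcing_bounds hck hk hT3 hT4 h1 h3 h5 h6
  obtain ⟨CR, hCR0, hR⟩ := exists_remainder₂_bound hck hc₀ hcE hk hT2 hT3 hT4 h1 h3 h4 h5 h6 hTD hGM
  have hc₁0 : 0 < min cE (ck / 8) := lt_min hcE (by positivity)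
  obtain ⟨Bm, hBm⟩ := hT2 (min cE (ck / 8)) (1 / 2) hc₁0 (by norm_num) (by norm_num)
  have hBmix : ∀ a b : ℝ, 0 ≤ a → 0 ≤ b → ∀ w : Site 4,
      Summable (fun y : Site 4 => gaussProfile ((1 - 1 / 2) * min cE (ck / 8)) a y *
        gaussProfile (min cE (ck / 8)) b (w - y)) ∧
      ∑' y : Site 4, gaussProfile ((1 - 1 / 2) * min cE (ck / 8)) a y * gaussProfile (min cE (ck / 8)) b (w - y) ≤
        max Bm 0 * gaussProfile ((1 - 1 / 2) * min cE (ck / 8)) (a + b) w :=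
    fun a b ha hb w => ⟨(hBm a b ha hb w).1, (hBm a b ha hb w).2.trans
      (mul_le_mul_of_nonneg_right (le_max_left _ _) (gaussProfile_nonneg _ _ _))⟩
  have hBm0 : 0 ≤ max Bm 0 := le_max_right _ _
  set Kerr : ℝ := (4 * Ck * (2 * K) + 4 * C₁ * (K * (1 + 4 * c₀)) + 4 * CR * (K * (1 + 2 * c₀))) * max Bm 0 with hKerr
  have hKerr0 : 0 ≤ Kerr := by rw [hKerr]; positivity
  refine ⟨c₀, hc₀, 16 * Kerr, fun t => ∑ α : Fin 4, pert1 t 0 α α,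
    fun t => -∑ α : Fin 4, ∫ s in (0 : ℝ)..t,
      (∑' y : Site 4, (pert0 (t - s) y * Q₃[s, -y] + pert1 (t - s) y * F[s, -y])) α α,
    fun θ t ht1 hθt => ?_⟩
  have ht : 0 < t := by linarith
  have hθ : |θ| ≤ c₀ := by nlinarith [abs_nonneg θ]
  -- the flux-free heat symbol is the free kernel
  have hfree : ∀ α : Fin 4, symHeat 0 t 0 α α = pert0 t 0 α α := by
    intro α; rw [symHeat, symLink_zero_eq, h2 t ht.le 0 0, sub_zero, pert0]
  -- continuity package and the Duhamel representation
  have hcont := fun θ t => continuity_package h1 h3 h4 h5 h6 θ t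
  have hrep : ∀ (θ : ℝ) {t : ℝ}, 0 < t → ∀ (w : Site 4) (α β : Fin 4),
      (R₂[θ, t, w]) α β = -∫ s in (0 : ℝ)..t, (∑' y : Site 4,
          Complex.exp (((θ / 2 * (wedge y w : ℤ) : ℝ) : ℂ) * Complex.I) •
            (symHeat θ (t - s) y * Q₂[θ, s, w - y])) α β :=
    fun θ t ht w α β => remainder₂_eq_integral hck hk hT3 hT4 h1 h3 h4 h5 h6 hTD θ ht w α β
  -- the per-entry expansion and the `e2` identity
  have hexp := fun α : Fin 4 => norm_remainder₂_origin_expansion_le hck hc₀ hcE hCk hCE hCR0 hK0 hC₁0 hBm0 hk hT5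
    hBmix hE₁ hq hGM hR hcont hrep θ ht hθ hθt α
  have he2 : ∑ α : Fin 4, ∫ s in (0 : ℝ)..t, (∑' y : Site 4, pert0 (t - s) y * F[s, -y]) α α = -e2 t :=
    sum_integral_leading_eq_neg_e2 h7 ht.le
      (fun s hs => (integrand_families hck hc₀ hcE hCk hCE hCR0 hK0 hC₁0 hBm0 hk hBmix hE₁ hq hGM hR θ
        hs.1 hs.2 hθ hθt).1)
      (fun α => (integrands_continuousOn_and_split hck hc₀ hcE hCk hCE hCR0 hK0 hC₁0 hBm0 hk hT5 hBmix hE₁ hq hGM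
        hR hcont θ ht.le hθ hθt α).2.1)
  -- regroup the difference as a sum of per-entry expansions
  have key : (∑ α : Fin 4, (symHeat θ t 0 α α - symHeat 0 t 0 α α)) -
      ((θ : ℂ) * (∑ α : Fin 4, pert1 t 0 α α) + (θ : ℂ) ^ 2 * e2 t +
        (θ : ℂ) ^ 3 * -∑ α : Fin 4, ∫ s in (0 : ℝ)..t,
          (∑' y : Site 4, (pert0 (t - s) y * Q₃[s, -y] + pert1 (t - s) y * F[s, -y])) α α) =
      ∑ α : Fin 4, ((R₂[θ, t, 0]) α α +
        (θ : ℂ) ^ 2 * (∫ s in (0 : ℝ)..t, (∑' y : Site 4, pert0 (t - s) y * F[s, -y]) α α) +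
        (θ : ℂ) ^ 3 * (∫ s in (0 : ℝ)..t,
          (∑' y : Site 4, (pert0 (t - s) y * Q₃[s, -y] + pert1 (t - s) y * F[s, -y])) α α)) := by
    have he2' : e2 t = -∑ α : Fin 4, ∫ s in (0 : ℝ)..t, (∑' y : Site 4, pert0 (t - s) y * F[s, -y]) α α := by
      rw [he2, neg_neg]
    rw [he2']
    simp only [hfree, Matrix.sub_apply, Matrix.smul_apply, smul_eq_mul, Finset.sum_add_distrib,
      Finset.sum_sub_distrib, ← Finset.mul_sum]
    ring
  rw [key]
  have hΓ0 : gaussProfile (min cE (ck / 8) / 2) t 0 = ((1 + t) ^ 2)⁻¹ := gaussProfile_zero_right _ _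
  calc ‖∑ α : Fin 4, ((R₂[θ, t, 0]) α α +
          (θ : ℂ) ^ 2 * (∫ s in (0 : ℝ)..t, (∑' y : Site 4, pert0 (t - s) y * F[s, -y]) α α) +
          (θ : ℂ) ^ 3 * (∫ s in (0 : ℝ)..t,
            (∑' y : Site 4, (pert0 (t - s) y * Q₃[s, -y] + pert1 (t - s) y * F[s, -y])) α α))‖
      ≤ ∑ α : Fin 4, ‖(R₂[θ, t, 0]) α α +
          (θ : ℂ) ^ 2 * (∫ s in (0 : ℝ)..t, (∑' y : Site 4, pert0 (t - s) y * F[s, -y]) α α) +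
          (θ : ℂ) ^ 3 * (∫ s in (0 : ℝ)..t,
            (∑' y : Site 4, (pert0 (t - s) y * Q₃[s, -y] + pert1 (t - s) y * F[s, -y])) α α)‖ :=
        norm_sum_le _ _
    _ ≤ ∑ _α : Fin 4, Kerr * θ ^ 4 * (1 + t) ^ 3 * gaussProfile (min cE (ck / 8) / 2) t 0 * t :=
        Finset.sum_le_sum fun α _ => hexp α
    _ = 4 * (Kerr * θ ^ 4 * (1 + t) ^ 3 * ((1 + t) ^ 2)⁻¹ * t) := by
        rw [Finset.sum_const, Finset.card_univ, Fintype.card_fin, hΓ0]; simp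
    _ = 4 * Kerr * θ ^ 4 * ((1 + t) * t) := by
        have : (1 + t) ^ 2 ≠ 0 := by positivity
        field_simp
    _ ≤ 4 * Kerr * θ ^ 4 * (4 * t ^ 2) :=
        mul_le_mul_of_nonneg_left (by nlinarith) (by positivity)
    _ = 16 * Kerr * θ ^ 4 * t ^ 2 := by ring

/-! ## Registered headline -/

/-- Registered headline of this helper file (aux stub `stub_secondOrderExpansionAuxO` of crux
stmt-QuantumFields-16786, line `Sketch`): the second-order expansion given the twisted Duhamel principle. -/
theorem stub_secondOrderExpansionAuxO : (∀ (θ T c B : ℝ), 0 < T → 0 < c → ∀ (X q : ℝ → Site 4 → Spin), (∀ w : Site 4, X 0 w = 0) → (∀ (w : Site 4) (α β : Fin 4), ContinuousOn (fun s => X s w α β) (Set.Icc 0 T)) → (∀ (w : Site 4) (α β : Fin 4), ContinuousOn (fun s => q s w α β) (Set.Icc 0 T)) → (∀ s ∈ Set.Ioo 0 T, ∀ (w : Site 4) (α β : Fin 4),   HasDerivAt (fun r => X r w α β)     ((-(∑ v ∈ nbr2 0, Complex.exp (((θ / 2 * (wedge v w : ℤ) : ℝ) : ℂ) * Complex.I)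 •         (sqKer (symLink θ) 0 v * X s (w - v))) - q s w) α β) s) → (∀ s ∈ Set.Icc 0 T, ∀ (w : Site 4) (α β : Fin 4), ‖X s w α β‖ ≤ B) → (∀ s ∈ Set.Icc 0 T, ∀ (w : Site 4) (α β : Fin 4), ‖q s w α β‖ ≤ B * gaussProfile c s w) → ∀ t ∈ Set.Icc 0 T, ∀ (w : Site 4) (α β : Fin 4),   X t w α β = -∫ s in (0 : ℝ)..t, (∑' y : Site 4,     Complex.exp (((θ / 2 * (wedge y w : ℤ) : ℝ) : ℂ) * Complex.I) •       (symHeat θ (t - s) y * q s (w - y))) α β) →((∃ C c : ℝ, 0 < c ∧ ∀ t : ℝ, 0 ≤ t → ∀ w : Site 4, |freeKer t w| ≤ C * gaussProfile c t w) ∧ (∀ c ε : ℝ, 0 < c → 0 < ε → ε < 1 → ∃ B : ℝ, ∀ a b : ℝ, 0 ≤ a → 0 ≤ b → ∀ w : Site 4, Summable (fun y : Site 4 => gaussProfile ((1 - ε) * c) a y * gaussProfile c b (w - y)) ∧ ∑' y : Site 4, gaussProfile ((1 - ε) * c) a y * gaussProfile c b (w - y) ≤ B * gaussProfile ((1 -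 ε) * c) (a + b) w) ∧ (∀ c ε : ℝ, 0 < c → 0 < ε → ε < 1 → ∀ j : ℕ, ∃ A : ℝ, ∀ t : ℝ, 0 ≤ t → ∀ w : Site 4, elen w ^ j * gaussProfile c t w ≤ A * Real.sqrt (1 + t) ^ j * gaussProfile ((1 - ε) * c) t w) ∧ (∀ c ε : ℝ, 0 < c → 0 < ε → ε < 1 → ∃ A : ℝ, ∀ t : ℝ, 0 ≤ t → ∀ w z : Site 4, elen z ≤ 2 → gaussProfile c t (w + z) ≤ A * gaussProfile ((1 - ε) * c) t w) ∧ (∀ c : ℝ, 0 < c → ∃ A : ℝ, ∀ t : ℝ, 0 ≤ t → Summable (fun y : Site 4 => gaussProfile c t y) ∧ ∑' y : Site 4, gaussProfile c t y ≤ A) ∧ (∀ c : ℝ, 0 < c → ∃ C : ℝ, ∀ (L : ℕ), 1 ≤ L → ∀ t : ℝ, 1 ≤ t → t ≤ (L : ℝ) ^ 2 → Summable (fun n : Site 4 => gaussProfile c t (fun μ => (L : ℤ) * n μ)) ∧ ∑' n : Site 4, (if n = 0 then 0 else gaussProfile c t (fun μ => (L : ℤ) * n μ)) ≤ C * Real.exp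 (-(c / 2 * (L : ℝ) ^ 2 / (t + (L : ℝ)))) / t ^ 2)) → ((∀ x y : Site 4, sqKer (fun _ => (1 : ℂ)) x y = ((hhat (y - x) : ℝ) : ℂ) • (1 : Spin)) ∧ (∀ t : ℝ, 0 ≤ t → ∀ x y : Site 4, heatKer (fun _ => (1 : ℂ)) t x y = ((freeKer t (y - x) : ℝ) : ℂ) • (1 : Spin)) ∧ (∀ w : Site 4, freeKer 0 w = if w = 0 then 1 else 0) ∧ (∀ (t : ℝ) (w : Site 4), HasDerivAt (fun s => freeKer s w) (-(∑ z ∈ nbr2 0, hhat z * freeKer t (w - z))) t) ∧ (∀ s r : ℝ, 0 ≤ s → 0 ≤ r → ∀ w : Site 4, HasSum (fun y : Site 4 => freeKer s y * freeKer r (w - y)) (freeKer (s + r) w)) ∧ (∀ t : ℝ, 0 ≤ t → ∀ (w : Site 4) (ν : Fin 4), t * (∑ z ∈ nbr2 0, ((z ν : ℤ) : ℝ) * hhat z * freeKer t (w - z)) + ((w ν : ℤ) : ℝ) * freeKer t w = 0) ∧ (∀ (t : ℝ) (w : Site 4), freeKer t (-w) = freeKer t w)) → (∃ c₀ : ℝ,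 0 < c₀ ∧ ∃ C c : ℝ, 0 < c ∧ ∀ θ t : ℝ, 0 ≤ t → |θ| ≤ c₀ → |θ| * t ≤ c₀ → ∀ (w : Site 4) (α β : Fin 4), ‖symHeat θ t w α β‖ ≤ C * gaussProfile c t w) → (∃ c₀ : ℝ, 0 < c₀ ∧ ∃ C : ℝ, ∃ a₁ a₃ : ℝ → ℂ, ∀ θ t : ℝ, 1 ≤ t → |θ| * t ≤ c₀ → ‖(∑ α : Fin 4, (symHeat θ t 0 α α - symHeat 0 t 0 α α)) - ((θ : ℂ) * a₁ t + (θ : ℂ) ^ 2 * e2 t + (θ : ℂ) ^ 3 * a₃ t)‖ ≤ C * θ ^ 4 * t ^ 2) :=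
  secondOrderExpansion_of_twistedDuhamel

end Summit.QuantumFields.QCD.Cruxes.QuarkLoopCoefficient.Sketch.SecondOrderExpansion

end
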